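import Mathlib
import Summits.NavierStokesRegularity.NavierStokesRegularity.Theorems.EulerZoomLiouvillePowerGaugeEulerLiouvilleSelfSimilarTopBadNodeArc
import HarnessLib.Audit

/-!
# Rung C1 of the crux `EulerZoomLiouville.PowerGaugeEulerLiouville`: the classical survivor's top bad node
# is a SINGULAR point of the stagnation set (no stagnation arc or ring through it)

Route №10 `EulerZoomLiouville` (NavierStokesRegularity), crux E = stmt-NavierStokesRegularity-19832,
tenure rung C1 (exactly self-similar members), registered residue `stub_selfSimilarExtremal`.
Twelfth file of the NODAL-CONTINUUM line (lineage ns-typeII-p1, gen 7): the portrait after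
`false_of_topBadNode_of_arc`.  Setting: `0 < γ < ½`, a NONTRIVIAL `C²` self-similar Euler profile
`(U, P)` (CIV 2026 (3.3)) with the far field (3.8).

* `not_onArc_topBadNode_of_ne_zero` — the degenerate top bad node `z♭` of
  `exists_degenerate_topBadNode_of_ne_zero` (non-vortical, unit stretching rate `≥ 1`, adherent to
  `{Ω ≠ 0}` which lies below `ℋ(z♭)`, `−γ ∈ spec DU(z♭)`) admits NO `C^{1,1}` arc of stagnation points
  `τ ↦ z♭ + τe + g(τ)` along a unit kernel vector `e` (`g ⊥ e`, `g(0) = 0`, `|g'| ≤ L|τ|`): some point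
  of every such arc is NOT a stagnation point.  So `z♭` is an endpoint, an accumulation point or an
  isolated point of the stagnation set along its kernel line — never an interior point of a stagnation
  curve, and on no `C^{1,1}` stagnation ring (CIV §4's stagnation circles through a top bad node are
  excluded).

WHAT THIS IS NOT: not NS, not E, not rung C1 — classical (`C²`) profiles with (3.8).
References: P. Constantin, M. Ignatova, V. Vicol, arXiv:2602.17570 (2026), §3.5, §4.
[ConstantinIgnatovaVicol2026Putative]
-/

noncomputable section

-- flat `Theorems/<Route><Decl>…` files of one crux share the namespace of the crux (tree convention)
set_option linter.dupNamespace false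

open Set Filter Topology Metric Function InnerProductSpace
open scoped RealInnerProductSpace NNReal

namespace Summit.NavierStokesRegularity.NavierStokesRegularity.Theorems.PowerGaugeEulerLiouville.NodalContinuum

open Literature.Analysis Literature.Analysis.FluidPDE Literature.Analysis.ODE
open Summit.NavierStokesRegularity.NavierStokesRegularity.Theorems.PowerGaugeEulerLiouville.NodalFiniteness

variable {γ C : ℝ} {c : EuclideanSpace ℝ (Fin 3)}
  {U : EuclideanSpace ℝ (Fin 3) → EuclideanSpace ℝ (Fin 3)} {P : EuclideanSpace ℝ (Fin 3) → ℝ}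

/-- **PORTRAIT: the degenerate top bad node is a SINGULAR point of the nodal set.**  Let `0 < γ < ½` and
let `(U, P)` be a NONTRIVIAL `C²` self-similar Euler profile with (3.8).  Then the top bad node `z♭` of
`exists_degenerate_topBadNode_of_ne_zero` — non-vortical, with a unit stretching rate `≥ 1`, adherent to
`{curl U ≠ 0}`, with `ℋ < ℋ(z♭)` there, and a kernel vector of `DV(z♭)` — admits NO `C^{1,1}` arc of
stagnation points `τ ↦ z♭ + τe + g(τ)` (`|τ| ≤ δ`) through it along a unit kernel vector `e` (`g ⊥ e`,
`g(0) = 0`, `|g'(τ)| ≤ L|τ|`): it is an endpoint, an accumulation point or an isolated point of the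
stagnation set along its kernel line, never an interior point of a stagnation curve (in particular it lies
on no `C^{1,1}` stagnation ring). [cite: ConstantinIgnatovaVicol2026Putative, §3.5, §4 (portrait not in print)] -/
theorem not_onArc_topBadNode_of_ne_zero (h : IsSelfSimilarEulerProfile γ c U P) (hγ : 0 < γ)
    (hγ2 : γ < 1 / 2) (hfar : HasSelfSimilarFarFieldWith γ c C U) (hU : U ≠ 0) :
    ∃ z ∈ selfSimilarNodalSet γ c U, curl U z = 0 ∧
      (∃ w : EuclideanSpace ℝ (Fin 3), ‖w‖ = 1 ∧ 1 ≤ ⟪fderiv ℝ U z w, w⟫) ∧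
      z ∈ closure {y | curl U y ≠ 0} ∧
      (∀ x, curl U x ≠ 0 → selfSimilarBernoulli γ c U P x < selfSimilarBernoulli γ c U P z) ∧
      (∃ v : EuclideanSpace ℝ (Fin 3), v ≠ 0 ∧ fderiv ℝ U z v = (-γ) • v) ∧
      ∀ (e : EuclideanSpace ℝ (Fin 3)), ‖e‖ = 1 → fderiv ℝ (selfSimilarTransport γ c U) z e = 0 →
        ∀ (g g' : ℝ → EuclideanSpace ℝ (Fin 3)) (δ L : ℝ), 0 < δ → 0 ≤ L → g 0 = 0 →
          (∀ τ, ⟪e, g τ⟫ = 0) → (∀ τ, HasDerivAt g (g' τ) τ) → (∀ τ, |τ| ≤ δ → ‖g' τ‖ ≤ L * |τ|) →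
          ∃ τ, |τ| ≤ δ ∧ z + τ • e + g τ ∉ selfSimilarNodalSet γ c U := by
  obtain ⟨z, hzN, hΩz, hbad, hcl, hconf, hv⟩ := exists_degenerate_topBadNode_of_ne_zero h hγ hγ2 hfar hU
  refine ⟨z, hzN, hΩz, hbad, hcl, hconf, hv, ?_⟩
  intro e he1 hAe g g' δ L hδ hL hg0 hge hgd hg'
  by_contra hall
  push Not at hall
  exact false_of_topBadNode_of_arc h hγ hγ2 hfar hzN hΩz hbad hcl hconf he1 hAe hδ hL hg0 hge hgd hg'
    hall

end Summit.NavierStokesRegularity.NavierStokesRegularity.Theorems.PowerGaugeEulerLiouville.NodalContinuum
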